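import Summits.ValiantsHypothesis.ValiantsHypothesis.Theorems.BarrierLeverChowBenchmarkPairsBlockPeelConcatTable

/-!
# Route BarrierLever — item 22038 `ChowBenchmarkPairs`, line `moore-peel`: the BLOCK PEEL, VII — TYPED NODE
# «COVER TRIPLE» and the reduction of CONJECTURE B3 to three laws on blocks of length `≤ 3`

Helper file (`--supports stmt-ValiantsHypothesis-22038`; cell valiant-natproofs, rung V4, 𝒟-side benchmark of record, line
`moore_peel`, planner RULING R58(c) = successor FIRST DUTY (HOME/STATUS.md l.1879: «TYPE the covering-triple lemma as a by-name
node `Stmt.conjCoverTriple` … + the kernel arrow `conjB3_of_conjCoverTriple` … ⇒ `Stmt.conjB3` ⇒ node #1 ∀h BY NAME»); seat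
val-np-p4 gen 31).  Closes NO item.  Three definitions (`Prop`s, BY NAME — not registered stubs, R30), kernel-only (no computation).

THE NODE (planner's text, verbatim): **`Stmt.conjCoverTriple`** — «for every bad-start double `{b, b+1}` that is singular, the
covering triple `{b, b+1, b+2}` is nonsingular»: `det G_b = 0 ∧ det J^{!}(b,2)(Λ) = 0 ⇒ det J^{!}(b,3)(Λ) ≠ 0` (symbolic block
determinants of `…BlockPeelRows`; Lean stage `b` carries `T_q`, `q < b`).  EVIDENCE (kit, memo HOME/val-np-p4/g30/memo/MEMO-valnp4-g30.md
§0.5 and HOME/val-np-p4/g28/memo §3): among the bad stages `b ≤ 20 069` of THEOREM W exactly 26 bad-start doubles are singular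
(`b` = 444, 726, 892, 1788, 2897, 2986, 2997, 3580, 5419, 5994, 6005, 7132, 7133, 7164, 7934, 11631, 11637, 11676, 11943, 13159, 13278,
14193, 14291, 14332, 15870, 18347) and EVERY one of the 26 covering triples is nonsingular (jobs E/D2, j330831, j330119, j330122).  The
corank of `G_b` is NOT the invariant (j330831: corank 1 ⇒ the double is full in all 40+ cases, the five isolated corank-4 stages
444/892/1788/3580/7164 have double deficiency exactly 3, but corank 2, 3, 8, 27, 86 give deficiencies 1, 1, 1, 3, 11) — so the node is
typed without a corank parameter.

THE HONEST ARROW.  `Stmt.conjCoverTriple` ALONE cannot give `Stmt.conjB3` by concatenation (`…BlockPeelConcat`): a triple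
`{i, i+1, i+2}` touching a bad stage has a good sub-tiling only as `{i} + {i+1, i+2}` or `{i, i+1} + {i+2}`, so
* good start `i`, bad `i+1` or `i+2` (patterns GBG, GGB, GBB): needs the PRECEDING/ENTRY blocks `{g, …, b}` (`g` good, `g+1..b` bad,
  `b ≤ g+2`) — CONJECTURE P′ of `…BlockPeelRuns` truncated at prefix length `≤ 3`: **`Stmt.conjPrefixThree`** (`conjPrefixThree_of_conjPrefix`);
* bad start `b` with `b+2` good (BGG, BBG): exactly `Stmt.conjCoverTriple` (or the full double `{b, b+1}` and the single `{b+2}`);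
* bad start `b` with `b+2` bad (BGB — three instances `≤ 20 069`: 11772, 11965, 14197, all full, kit j332429 — and BBB, the 3-runs):
  no sub-tiling exists; the triple outright: **`Stmt.conjBadEnds`**.
Hence (this file, kernel): **`conjB3_of_conjCoverTriple : conjPrefixThree → conjCoverTriple → conjBadEnds → conjB3`**, the converse
arrows `conjCoverTriple_of_conjB3`, `conjBadEnds_of_conjB3` (so, GIVEN P′≤3, `conjB3 ↔ conjCoverTriple ∧ conjBadEnds`:
`conjB3_iff_cover`), and the composition to node #1 VERBATIM for every `h`: `segmentMeanValue_of_cover`.  All three laws are about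
explicit integer/`Λ` matrices of size `≤ 3b + 3`; each holds numerically at every instance `≤ 20 069` (memo g30 §0.5, coverage checker
HOME/val-np-p4/g30/num/b3_coverage.py) and in the kernel/computationally at every instance `≤ 1457` (`conjB3_instance_of_le_1457`,
`conjPrefixUpTo_1459_cert`).

WHAT THIS IS NOT: the three laws, `Stmt.conjB3` (∀ i) and node #1 `stub_segmentMeanValue` (∀ h) stay OPEN; nothing on crux
stmt-ValiantsHypothesis-14610 or on `VP` versus `VNP`.
-/

set_option linter.dupNamespace false

namespace Summit.ValiantsHypothesis.ValiantsHypothesis.Theorems.BarrierLever.MoorePeel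

open Polynomial Finset

/-! ## 18. The three laws on blocks of length at most three -/

/-- **CONJECTURE P′ at prefix length `≤ 3`** (the entry blocks of a bad run): for a good stage `g ≥ 1` followed by bad stages
`g+1, …, b` with `b ≤ g + 2`, the tied block `{g, …, b}` has `det J^{!}(g, b+1-g)(Λ) ≠ 0` — `Stmt.conjPrefix` of `…BlockPeelRuns`
restricted to blocks of length `2` or `3`. -/
def Stmt.conjPrefixThree : Prop :=
  ∀ g b : ℕ, 1 ≤ g → g < b → b ≤ g + 2 → (peelMatrix g).det ≠ 0 → (∀ i, g < i → i ≤ b → (peelMatrix i).det = 0) →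
    (blockMatrix Nat.factorial g (b + 1 - g)
      (fun s : Fin (b + 1 - g) => (MvPolynomial.X s : MvPolynomial (Fin (b + 1 - g)) ℤ))).det ≠ 0

/-- **CONJECTURE «COVER TRIPLE»** (planner RULING R58(c), typed verbatim): for every bad stage `b ≥ 1` (`det G_b = 0`) whose
bad-start double is singular (`det J^{!}(b,2)(Λ) = 0`), the covering triple is nonsingular: `det J^{!}(b,3)(Λ) ≠ 0`. -/
def Stmt.conjCoverTriple : Prop :=
  ∀ b : ℕ, 1 ≤ b → (peelMatrix b).det = 0 →
    (blockMatrix Nat.factorial b 2 (fun s : Fin 2 => (MvPolynomial.X s : MvPolynomial (Fin 2) ℤ))).det = 0 →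
    (blockMatrix Nat.factorial b 3 (fun s : Fin 3 => (MvPolynomial.X s : MvPolynomial (Fin 3) ℤ))).det ≠ 0

/-- **CONJECTURE «BAD ENDS»**: a triple `{b, b+1, b+2}` whose two end stages are bad (`det G_b = det G_{b+2} = 0`; no good
sub-tiling can exist) is nonsingular: `det J^{!}(b,3)(Λ) ≠ 0`. -/
def Stmt.conjBadEnds : Prop :=
  ∀ b : ℕ, 1 ≤ b → (peelMatrix b).det = 0 → (peelMatrix (b + 2)).det = 0 →
    (blockMatrix Nat.factorial b 3 (fun s : Fin 3 => (MvPolynomial.X s : MvPolynomial (Fin 3) ℤ))).det ≠ 0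

/-! ## 19. The easy arrows -/

/-- P′ implies its truncation at prefix length `≤ 3`. -/
theorem conjPrefixThree_of_conjPrefix (hP : Stmt.conjPrefix) : Stmt.conjPrefixThree :=
  fun g b h1 hgb _ hg hbad => hP g b h1 hgb hg hbad

/-- B3 implies «cover triple». -/
theorem conjCoverTriple_of_conjB3 (hB3 : Stmt.conjB3) : Stmt.conjCoverTriple :=
  fun b hb _ _ => hB3 b hb

/-- B3 implies «bad ends». -/
theorem conjBadEnds_of_conjB3 (hB3 : Stmt.conjB3) : Stmt.conjBadEnds :=
  fun b hb _ _ => hB3 b hb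

/-! ## 20. Good-start triples from P′≤3, bad-start triples from the two bad-start laws -/

/-- **Good-start triples.**  Under P′≤3 every triple `{i, i+1, i+2}` starting at a GOOD stage `i ≥ 1` has
`det J^{!}(i,3)(Λ) ≠ 0`: patterns GGG (three singles), GGB (`{i}` + entry double `{i+1, i+2}`), GBG (entry double `{i, i+1}` +
`{i+2}`), GBB (entry triple). -/
theorem det_blockMatrix_three_ne_zero_of_good_start (hP3 : Stmt.conjPrefixThree) (i : ℕ) (hi : 1 ≤ i)
    (hg : (peelMatrix i).det ≠ 0) :
    (blockMatrix Nat.factorial i 3 (fun s : Fin 3 => (MvPolynomial.X s : MvPolynomial (Fin 3) ℤ))).det ≠ 0 := by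
  by_cases h1 : (peelMatrix (i + 1)).det = 0
  · by_cases h2 : (peelMatrix (i + 2)).det = 0
    · -- GBB: the entry triple `{i, i+1, i+2}` is a P′ block
      have key := hP3 i (i + 2) hi (by omega) le_rfl hg (fun j hj1 hj2 => by
        rcases (show j = i + 1 ∨ j = i + 2 by omega) with rfl | rfl
        · exact h1
        · exact h2)
      exact det_blockMatrix_X_ne_zero_of_eq Nat.factorial i (show 3 = i + 2 + 1 - i by omega) key
    · -- GBG: the entry double `{i, i+1}`, then the good single `{i+2}`
      have hD := hP3 i (i + 1) hi (by omega) (by omega) hg (fun j hj1 hj2 => by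
        obtain rfl : j = i + 1 := by omega
        exact h1)
      have hD' := det_blockMatrix_X_ne_zero_of_eq Nat.factorial i (show 2 = i + 1 + 1 - i by omega) hD
      rw [← kpeelMatrix_factorial] at h2
      exact det_blockMatrix_three_ne_zero_of_double_single Nat.factorial (fun k => Nat.factorial_ne_zero k) i hi hD' h2
  · by_cases h2 : (peelMatrix (i + 2)).det = 0
    · -- GGB: the good single `{i}`, then the entry double `{i+1, i+2}`
      have hD := hP3 (i + 1) (i + 2) (by omega) (by omega) (by omega) h1 (fun j hj1 hj2 => by
        obtain rfl : j = i + 2 := by omega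
        exact h2)
      have hD' := det_blockMatrix_X_ne_zero_of_eq Nat.factorial (i + 1) (show 2 = i + 2 + 1 - (i + 1) by omega) hD
      rw [← kpeelMatrix_factorial] at hg
      exact det_blockMatrix_three_ne_zero_of_single_double Nat.factorial (fun k => Nat.factorial_ne_zero k) i hi hg hD'
    · -- GGG: three good singles
      rw [← kpeelMatrix_factorial] at hg h1 h2
      exact det_blockMatrix_three_ne_zero_of_singles Nat.factorial (fun k => Nat.factorial_ne_zero k) i hi hg h1 h2

/-- **Bad-start triples.**  Under «cover triple» and «bad ends» every triple `{b, b+1, b+2}` starting at a BAD stage `b ≥ 1`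
has `det J^{!}(b,3)(Λ) ≠ 0`: `b+2` bad ⇒ «bad ends»; `b+2` good and the double `{b, b+1}` singular ⇒ «cover triple»; `b+2` good
and the double full ⇒ concatenation. -/
theorem det_blockMatrix_three_ne_zero_of_bad_start (hCT : Stmt.conjCoverTriple) (hBE : Stmt.conjBadEnds) (b : ℕ)
    (hb1 : 1 ≤ b) (hb : (peelMatrix b).det = 0) :
    (blockMatrix Nat.factorial b 3 (fun s : Fin 3 => (MvPolynomial.X s : MvPolynomial (Fin 3) ℤ))).det ≠ 0 := by
  by_cases h2 : (peelMatrix (b + 2)).det = 0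
  · exact hBE b hb1 hb h2
  · by_cases hD : (blockMatrix Nat.factorial b 2 (fun s : Fin 2 => (MvPolynomial.X s : MvPolynomial (Fin 2) ℤ))).det = 0
    · exact hCT b hb1 hb hD
    · rw [← kpeelMatrix_factorial] at h2
      exact det_blockMatrix_three_ne_zero_of_double_single Nat.factorial (fun k => Nat.factorial_ne_zero k) b hb1 hD h2

/-! ## 21. THE ARROW: the three laws give CONJECTURE B3, hence node #1 for every `h` -/

/-- **THE ARROW `P′≤3 ∧ COVER TRIPLE ∧ BAD ENDS ⇒ B3`** (planner RULING R58(c): `conjB3_of_conjCoverTriple`, with the two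
companion laws the concatenation argument provably needs). -/
theorem conjB3_of_conjCoverTriple (hP3 : Stmt.conjPrefixThree) (hCT : Stmt.conjCoverTriple) (hBE : Stmt.conjBadEnds) :
    Stmt.conjB3 := by
  intro i hi
  by_cases hb : (peelMatrix i).det = 0
  · exact det_blockMatrix_three_ne_zero_of_bad_start hCT hBE i hi hb
  · exact det_blockMatrix_three_ne_zero_of_good_start hP3 i hi hb

/-- **Given P′≤3, CONJECTURE B3 is EQUIVALENT to the two bad-start laws.** -/
theorem conjB3_iff_cover (hP3 : Stmt.conjPrefixThree) : Stmt.conjB3 ↔ Stmt.conjCoverTriple ∧ Stmt.conjBadEnds :=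
  ⟨fun hB3 => ⟨conjCoverTriple_of_conjB3 hB3, conjBadEnds_of_conjB3 hB3⟩,
    fun h => conjB3_of_conjCoverTriple hP3 h.1 h.2⟩

/-- The same with the full CONJECTURE P′ of `…BlockPeelRuns` in place of its truncation. -/
theorem conjB3_iff_cover_of_conjPrefix (hP : Stmt.conjPrefix) : Stmt.conjB3 ↔ Stmt.conjCoverTriple ∧ Stmt.conjBadEnds :=
  conjB3_iff_cover (conjPrefixThree_of_conjPrefix hP)

/-- **The three laws give kernel poisedness at EVERY height** (`…BlockPeelTriples`' tiling by singles `{1}, {2}` and triples). -/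
theorem kernelPoisedAt_factorial_of_cover (hP3 : Stmt.conjPrefixThree) (hCT : Stmt.conjCoverTriple) (hBE : Stmt.conjBadEnds)
    (h : ℕ) : KernelPoisedAt Nat.factorial h :=
  kernelPoisedAt_factorial_of_conjB3 (conjB3_of_conjCoverTriple hP3 hCT hBE) h

/-- **THE ARROW TO NODE #1, verbatim**: under P′≤3, «cover triple» and «bad ends» the line file's `SegmentMeanValueAt h` holds
for EVERY `h` — the registered node #1 `stub_segmentMeanValue` (`∀ h, SegmentMeanValueAt h`). -/
theorem segmentMeanValue_of_cover (hP3 : Stmt.conjPrefixThree) (hCT : Stmt.conjCoverTriple) (hBE : Stmt.conjBadEnds) (h : ℕ) :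
    ∀ (r : ℕ) (u : Fin r → Finset (Fin h)), Function.Injective u → (∀ i, (u i).card ≤ 2) →
      (∀ S : Finset (Fin h), S.card ≤ 2 → ∃ i, u i = S) →
      ∃ P : Fin h → Fin h → ℂ,
        (Matrix.of fun i j : Fin r =>
          ∑ g : (↥(benchCols h r j) → ↥(u i)), (∏ c : ↥(benchCols h r j), P (g c) c) *
            ∏ a : ↥(u i),
              ((Finset.univ.filter fun c : ↥(benchCols h r j) => g c = a).card.factorial : ℂ)).det ≠ 0 :=
  kernelPoisedAt_factorial_of_cover hP3 hCT hBE h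

/-! ## 22. Where the three laws have content: THEOREM W's decidable bad-stage predicate -/

/-- «Cover triple» and «bad ends» are vacuous at the good stages: if `badStageFast b = false` then both hypotheses
`det G_b = 0` are absurd (`det_peelMatrix_eq_zero_iff_badStageFast`). -/
theorem not_det_peelMatrix_eq_zero_of_badStageFast (b : ℕ) (hgood : badStageFast b = false) : (peelMatrix b).det ≠ 0 := by
  rw [Ne, det_peelMatrix_eq_zero_iff_badStageFast, hgood]
  exact Bool.false_ne_true

/-- P′≤3 has content only at the good stages `g` with `g + 1` bad: if `badStageFast (g+1) = false` every P′≤3 instance at `g`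
is vacuous. -/
theorem conjPrefixThree_vacuous (g b : ℕ) (hgb : g < b) (hgood : badStageFast (g + 1) = false)
    (hbad : ∀ i, g < i → i ≤ b → (peelMatrix i).det = 0) : False :=
  not_det_peelMatrix_eq_zero_of_badStageFast (g + 1) hgood (hbad (g + 1) (by omega) (by omega))

end Summit.ValiantsHypothesis.ValiantsHypothesis.Theorems.BarrierLever.MoorePeel
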